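import Literature.NumberTheory.EllipticCurves.Kato2004.ZetaSideInputsContragredient
import Literature.NumberTheory.EllipticCurves.Kato2004.IwasawaCohomologyUniqueProofs
import Literature.NumberTheory.EllipticCurves.IwasawaSelmerDualUniquenessProofs
import Literature.NumberTheory.EllipticCurves.KatoFineSelmerDualUniquenessProofs
import HarnessLib

/-!
# Kato 2004 (Astérisque 295), the zeta side of §17.13 at `(p)`, duals contragredient — TRANSPORT CLOSURE:
# the package `ZetaSideInputsContra W p f κ γ I D Y` moves along the uniqueness isomorphisms of the three
# pinned modules, so the fact `exists_zetaSideInputs_contra` (∀ pinned `I, D, Y`) follows from ONE model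
# per `(E, p, f, κ, γ)` (proofs only; sibling of `ZetaSideInputsContragredient`)

Topic `NumberTheory/EllipticCurves`, sub-directory `Kato2004` (namespace = path).  Cell `bsd-smallim` (rung
K6 of `BirchSwinnertonDyer`, class X9, route `SmallImageMuTransfer`, crux `MuTransfer` = item
stmt-BirchSwinnertonDyer-19629, line `f1_fine`), seat `bsd-line-k6-p2` gen 5 (D-0154 KEY (146) row 9,
2026-08-28).  Sibling PROOF file of `Kato2004/ZetaSideInputsContragredient.lean` (this seat, gen 4: the
hypothesis structure `ZetaSideInputsContra`, the construction fact `exists_zetaSideInputs_contra` = ZSᶜ, the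
published input of the crux at its true size and print-exact); that file is NOT edited (D-0014).
THEOREMS ONLY: no definition, no named fact, no `instance`, no notation; nothing asserted; `#print axioms`
standard; BSD is not advanced and item 19629 stays open by design (ZSᶜ has no `_holds`: Kato's
CONSTRUCTION, size XL).

## Why (honest framing: what a port of ZSᶜ must deliver, minus the plumbing)

ZSᶜ quantifies over ALL pinned data: every `I : IwasawaH1Data W p κ γ` (Kato's `𝐇¹ = lim H¹(ℤ[ζ_{pⁿ}, 1/p], T)`
on the `Δ`-trivial component, a HYPOTHESIS structure pinned by its projections), every
`D : W.SelmerDualData κ γ⁻¹` and every `Y : W.FineSelmerDualData κ γ⁻¹` (the Pontryagin duals of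
`Sel_{p^∞}(E/ℚ_∞)` / `Sel₀(ℚ_∞, E[p^∞])` in their contragredient `Λ`-structure, hypothesis structures pinned
by `toDual`).  Its consumer (`Summits/…/Theorems/SmallImageMuTransferMuTransferOfZetaSideContra.lean`) calls
it at data it does not choose (an arbitrary `I`, the Iwasawa-involution twist `D′` of an arbitrary γ-keyed
`D`, the twist of a canonical fine dual).  A PORT of Kato's construction, on the other hand, produces the
package for ONE triple — the modules it actually builds.  The gap is pure algebra, discharged here once and
for all from the tree's three uniqueness theorems:

* `IwasawaH1Data.exists_linearEquiv` (`Kato2004/IwasawaCohomologyUniqueProofs`): any two `I`, `I'` are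
  `Λ`-isomorphic COMPATIBLY WITH THE PROJECTIONS `proj n` (for `γ` a topological generator);
* `WeierstrassCurve.SelmerDualData.exists_linearEquiv` (`IwasawaSelmerDualUniquenessProofs`): any two `D`,
  `D'` of the same key — ANY key, here `γ⁻¹` — have `Λ`-isomorphic modules;
* `WeierstrassCurve.FineSelmerDualData.exists_linearEquiv` (`KatoFineSelmerDualUniquenessProofs`, this
  seat gen 5): the same for fine duals at ANY key.

## What is here

* `isEulerSystemClass_of_proj_eq` — the predicate `IsEulerSystemClass W p κ γ I s` («`s` is the `Λ`-adic
  class of a GENUINE integral Euler system», `Kato2004/EulerSystemClasses`) depends on `(I, s)` only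
  through the family of projections `(I.proj n s)_n`; hence it moves along projection-compatible maps, and
  (`map_span_isEulerSystemClass_le`) so does the `Λ`-span of such classes.
* `ZetaSideInputsContra.nonempty_transport` — **transport of the package**: from
  `K : ZetaSideInputsContra W p f κ γ I D Y` and `Λ`-isomorphisms `eI : I.H ≃ I'.H` (projection-compatible),
  `eD : D.X ≃ D'.X`, `eY : Y.X ≃ Y'.X`, a package for `(I', D', Y')`: SAME `P`, `col` (so Prop. 17.11 and
  the `(p)`-clause are untouched), `loc ∘ eI⁻¹`, `eD ∘ toX`, `Z ↦ eI(Z)`, `π ↦ eY ∘ π ∘ eD⁻¹`; exactness,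
  surjectivity, the span clause and the `(p)`-clause are equalities of submodules under isomorphisms.
* `exists_zetaSideInputs_contra_of_model` — **ZSᶜ from ONE model per `(E, p, f, κ, γ)`**: if for every
  admissible `(W, p, f, κ, γ)` there EXIST `I, D, Y` with `Nonempty (ZetaSideInputsContra W p f κ γ I D Y)`,
  then `exists_zetaSideInputs_contra`.  The hypothesis is spelled INLINE (no new named fact is minted: it
  is trivially implied by ZSᶜ given that the three kinds of data exist — `nonempty_iwasawaH1Data_holds`,
  `SelmerDualData` by twisting, `nonempty_fineSelmerDualData'` — and, by this theorem, implies it; the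
  published input of record stays `exists_zetaSideInputs_contra`).

So the porting checklist of ZSᶜ (the cell's `ZS-AUDIT.md`, evidence #10 on the item) loses its transport
line: construct Kato's objects ONCE — `𝐇¹` with its localisation `loc : 𝐇¹ → P = 𝐇¹_loc(T)/𝐇¹_loc(T')`
((17.13.3)), the Coleman map `col : P ↪ Λ` (Prop. 17.11), the Poitou–Tate maps `P → X → X₀` for the
CONSTRUCTED duals ((17.13.1), (14.9.3)), the span `Z` of the integral zeta elements (Thm. 12.6, Ex. 13.3)
and the `(p)`-clause (Thm. 12.5 (1), 16.6 (2), 17.5, p. 280) — and ZSᶜ follows for every pinned triple.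

## References

* K. Kato, Astérisque 295 (2004): §12.2 (12.2.1) (p. 220) and §13.8 (p. 228) (`𝐇¹` as the limit of the
  levels; uniqueness of the pin); Thm. 12.5 (1) (p. 221), Thm. 12.6 (p. 222), Ex. 13.3 (p. 225), (14.9.3)
  (p. 240), Thm. 16.6 (2) (p. 271), §17.3 (p. 273), 17.5 (p. 274), Prop. 17.11 (p. 277), §17.13 (pp. 279–280).
  [Kato2004Asterisque]
* R. Greenberg, LNM 1716 (1999), §1 (PDF p. 60: the `Λ`-module structure of the Pontryagin duals is forced).
  [GreenbergLNM1716]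
* S. Lang, *Cyclotomic Fields I and II*, GTM 121 (1990), Ch. 5 §1 Thm. 1.1 (compatible systems of
  `ℤ_p[X]/(ω_n)`-modules). [Lang1990]
* Tree: `Kato2004/ZetaSideInputsContragredient.lean` (the structure and the fact; docstring READING inherited),
  `Kato2004/EulerSystemClasses.lean` (`IsEulerSystemClass`), `Kato2004/IwasawaCohomologyUniqueProofs.lean`,
  `IwasawaSelmerDualUniquenessProofs.lean`, `KatoFineSelmerDualUniquenessProofs.lean`.
-/

noncomputable section

open scoped MatrixGroups ModularForm
open Field CongruenceSubgroup
open Literature.NumberTheory.GaloisRepresentations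
open Literature.NumberTheory.EllipticCurves Literature.NumberTheory.EllipticCurves.ModularForms
open Literature.NumberTheory.EllipticCurves.Kato2004.EulerSystemValues
open Literature.NumberTheory.EllipticCurves.IwasawaAlgebra

namespace Literature.NumberTheory.EllipticCurves.Kato2004

open Module

/-! ## §1 Genuine Euler-system classes move along projection-compatible maps -/

section EulerSystemClassTransport

variable {W : WeierstrassCurve ℚ} [W.IsElliptic] {p : ℕ} [Fact p.Prime]
  [ContinuousSMul ℤ_[p] (W.tateModule p)] [Module.Free ℤ_[p] (W.tateModule p)]
  [Module.Finite ℤ_[p] (W.tateModule p)] {κ : ZpExtension ℚ p} {γ : absoluteGaloisGroup ℚ}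

/-- **`IsEulerSystemClass` depends on `(I, s)` only through the projections `(I.proj n s)_n`.**  If
`s' ∈ I'.H` and `s ∈ I.H` have the same projection to every layer `H¹(ℚ_n, T_pW)`, and `s` is the
`Λ`-adic class of a genuine integral Euler system for the pin `I` (tree `IsEulerSystemClass`: an Euler
system `z` away from a finite `S`, integral at every level, whose `p`-power line traces to the layer
components of `s`), then so is `s'` for the pin `I'` — with the SAME system `z`.  Kato §13.8 (p. 228):
the `Λ`-adic class of `(z_{pⁿ})_n` is determined by its layer components.
[cite: Kato2004Asterisque, §12.2 (p. 220) and §13.8 (p. 228)] -/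
theorem isEulerSystemClass_of_proj_eq {I I' : IwasawaH1Data W p κ γ} {s : I.H} {s' : I'.H}
    (h : ∀ n : ℕ, I'.proj n s' = I.proj n s) (hs : IsEulerSystemClass W p κ γ I s) :
    IsEulerSystemClass W p κ γ I' s' := by
  obtain ⟨S, hS, z, hz, hint, hle, hproj⟩ := hs
  exact ⟨S, hS, z, hz, hint, hle, fun n ↦ (h n).trans (hproj n)⟩

/-- Along a projection-compatible `Λ`-linear map `e : I.H → I'.H` (`I'.proj n (e x) = I.proj n x`), the
`Λ`-span of the genuine Euler-system classes of `I` maps into that of `I'` (`isEulerSystemClass_of_proj_eq`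
on generators).  For the uniqueness isomorphism of `IwasawaH1Data.exists_linearEquiv` this is the statement
that Kato's Thm. 12.6 span clause is a property of `𝐇¹`, not of its pin.
[cite: Kato2004Asterisque, §12.2 (p. 220), Thm. 12.6 (p. 222) and §13.8 (p. 228)] -/
theorem map_span_isEulerSystemClass_le {I I' : IwasawaH1Data W p κ γ}
    (e : I.H →ₗ[IwasawaAlgebra p] I'.H) (he : ∀ (n : ℕ) (x : I.H), I'.proj n (e x) = I.proj n x) :
    Submodule.map e (Submodule.span (IwasawaAlgebra p) {s : I.H | IsEulerSystemClass W p κ γ I s}) ≤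
      Submodule.span (IwasawaAlgebra p) {s : I'.H | IsEulerSystemClass W p κ γ I' s} := by
  rw [Submodule.map_span_le]
  intro s hs
  exact Submodule.subset_span (isEulerSystemClass_of_proj_eq (fun n ↦ he n s) hs)

end EulerSystemClassTransport

/-! ## §2 Transport of the contragredient zeta-side package along isomorphisms of the three pinned modules -/

section Transport

variable {W : WeierstrassCurve ℚ} [W.IsElliptic] [W.IsGloballyMinimal] {p : ℕ} [Fact p.Prime]
  [ContinuousSMul ℤ_[p] (W.tateModule p)] [Module.Free ℤ_[p] (W.tateModule p)]
  [Module.Finite ℤ_[p] (W.tateModule p)] {N : ℕ} [NeZero N] {f : CuspForm (Gamma0 N) 2}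
  {κ : ZpExtension ℚ p} {γ : absoluteGaloisGroup ℚ}
  {I I' : IwasawaH1Data W p κ γ} {D D' : W.SelmerDualData κ γ⁻¹} {Y Y' : W.FineSelmerDualData κ γ⁻¹}

omit [NeZero N] in
/-- **Transport of Kato's contragredient zeta-side package.**  Given `K : ZetaSideInputsContra W p f κ γ I D Y`
and `Λ`-isomorphisms `eI : I.H ≃ I'.H` compatible with all projections (the uniqueness isomorphism of the pin
`𝐇¹_Γ(T_pW)`, `IwasawaH1Data.exists_linearEquiv`), `eD : D.X ≃ D'.X` and `eY : Y.X ≃ Y'.X` (uniqueness of the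
Pontryagin duals, `SelmerDualData.exists_linearEquiv` / `FineSelmerDualData.exists_linearEquiv`), the package
for `(I', D', Y')`: the SAME abstract `P = 𝐇¹_loc(T)/𝐇¹_loc(T')` and Coleman map `col : P ↪ Λ` (Prop. 17.11
and the `(p)`-clause of Thm. 12.5 (1)/16.6 (2)/17.5/p. 280 are statements in `P` and `Λ`, untouched);
`loc ↦ loc ∘ eI⁻¹`, `toX ↦ eD ∘ toX` ((17.13.1) exact at `P`: kernels and ranges under isomorphisms);
`Z ↦ eI(Z)` (Thm. 12.6 span clause: `map_span_isEulerSystemClass_le`); `π ↦ eY ∘ π ∘ eD⁻¹` ((14.9.3):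
surjective, exact after `eD ∘ toX`).  Pure algebra; nothing of Kato's construction is used or asserted.
[cite: Kato2004Asterisque, §12.2 (p. 220), Thm. 12.6 (p. 222), (14.9.3) (p. 240), Prop. 17.11 (p. 277) and §17.13 (pp. 279–280)]
[cite: GreenbergLNM1716, §1 (after Conj. 1.3)] -/
theorem ZetaSideInputsContra.nonempty_transport (K : ZetaSideInputsContra W p f κ γ I D Y)
    (eI : I.H ≃ₗ[IwasawaAlgebra p] I'.H) (heI : ∀ (n : ℕ) (x : I.H), I'.proj n (eI x) = I.proj n x)
    (eD : D.X ≃ₗ[IwasawaAlgebra p] D'.X) (eY : Y.X ≃ₗ[IwasawaAlgebra p] Y'.X) :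
    Nonempty (ZetaSideInputsContra W p f κ γ I' D' Y') := by
  -- (17.13.1) exact at `P` after transport: `ker (eD ∘ toX) = ker toX = range loc = range (loc ∘ eI⁻¹)`
  have hexP : Function.Exact (K.loc ∘ₗ eI.symm.toLinearMap) (eD.toLinearMap ∘ₗ K.toX) := by
    rw [LinearMap.exact_iff, LinearMap.ker_comp_of_ker_eq_bot _ eD.ker,
      LinearMap.range_comp_of_range_eq_top _ eI.symm.range]
    exact LinearMap.exact_iff.mp K.exact_P
  -- (14.9.3) exact at `X` after transport: `ker (eY ∘ π ∘ eD⁻¹) = eD (ker π) = eD (range toX) = range (eD ∘ toX)`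
  have hexX : Function.Exact (eD.toLinearMap ∘ₗ K.toX)
      (eY.toLinearMap ∘ₗ K.π ∘ₗ eD.symm.toLinearMap) := by
    rw [LinearMap.exact_iff, LinearMap.ker_comp_of_ker_eq_bot _ eY.ker, LinearMap.ker_comp,
      LinearMap.range_comp, Submodule.map_equiv_eq_comap_symm, ← LinearMap.exact_iff.mp K.exact_toX_π]
  refine ⟨{ P := K.P
            loc := K.loc ∘ₗ eI.symm.toLinearMap
            toX := eD.toLinearMap ∘ₗ K.toX
            exact_P := hexP
            col := K.col
            col_injective := K.col_injective
            Z := Submodule.map eI.toLinearMap K.Z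
            Z_le_span := (Submodule.map_mono K.Z_le_span).trans
              (map_span_isEulerSystemClass_le eI.toLinearMap heI)
            π := eY.toLinearMap ∘ₗ K.π ∘ₗ eD.symm.toLinearMap
            π_surjective := eY.surjective.comp (K.π_surjective.comp eD.symm.surjective)
            exact_toX_π := hexX
            exists_notMem_smul_mem := fun hirr G₁ hG₁ ↦ ?_ }⟩
  -- the `(p)`-clause: `col (loc Z)` is unchanged, `(col ∘ loc ∘ eI⁻¹)(eI Z) = col (loc Z)`
  obtain ⟨s, hs, hsG⟩ := K.exists_notMem_smul_mem hirr G₁ hG₁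
  refine ⟨s, hs, ?_⟩
  obtain ⟨z, hz, hzG⟩ := Submodule.mem_map.mp hsG
  refine Submodule.mem_map.mpr ⟨eI z, Submodule.mem_map_of_mem hz, ?_⟩
  rw [← hzG]
  simp only [LinearMap.coe_comp, Function.comp_apply, LinearEquiv.coe_coe, LinearEquiv.symm_apply_apply]

end Transport

/-! ## §3 ZSᶜ from ONE model per `(E, p, f, κ, γ)` -/

/-- **`exists_zetaSideInputs_contra` (ZSᶜ) follows from ONE model per admissible `(E, p, f, κ, γ)`.**  If for
every elliptic `W/ℚ` on a globally minimal model (structure facts of `T_pW` as instance binders), every odd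
good ordinary `p`, the cyclotomic `κ` with normalised topological generator `γ` matching the cyclotomic
variable, and every newform `f` of `W` — exactly the outer binders of ZSᶜ — there EXIST pinned data `I`, `D`,
`Y` carrying Kato's contragredient zeta-side package, then the package exists for ALL pinned data, i.e. ZSᶜ
holds: transport (`ZetaSideInputsContra.nonempty_transport`) along the uniqueness isomorphisms
`IwasawaH1Data.exists_linearEquiv` (projection-compatible, needs `κ.IsTopGenerator γ`),
`SelmerDualData.exists_linearEquiv` and `FineSelmerDualData.exists_linearEquiv` (any key, here `γ⁻¹`).
The hypothesis is what a port of Kato's construction (§§8, 12, 16, 17 for `f_E`) delivers; it is stated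
inline — no new named fact; the published input of record remains `exists_zetaSideInputs_contra`.
[cite: Kato2004Asterisque, §12.2 (p. 220), Thm. 12.5 (1) (p. 221), Thm. 12.6 (p. 222), (14.9.3) (p. 240), Thm. 16.6 (2) (p. 271), Prop. 17.11 (p. 277) and §17.13 (pp. 279–280)]
[cite: GreenbergLNM1716, §1 (after Conj. 1.3)] [cite: Lang1990, Ch. 5 §1 Thm. 1.1] -/
theorem exists_zetaSideInputs_contra_of_model
    (h : ∀ (W : WeierstrassCurve ℚ) [W.IsElliptic] [W.IsGloballyMinimal] (p : ℕ) [Fact p.Prime]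
      [ContinuousSMul ℤ_[p] (W.tateModule p)] [Module.Free ℤ_[p] (W.tateModule p)]
      [Module.Finite ℤ_[p] (W.tateModule p)] {N : ℕ} [NeZero N] (f : CuspForm (Gamma0 N) 2)
      (κ : ZpExtension ℚ p) (γ : absoluteGaloisGroup ℚ),
      p ≠ 2 → IsOrdinaryAt W p → κ.IsCyclotomic → κ.IsTopGenerator γ → IsCyclotomicVariable p γ →
      IsNewformOf W f →
      ∃ (I : IwasawaH1Data W p κ γ) (D : W.SelmerDualData κ γ⁻¹) (Y : W.FineSelmerDualData κ γ⁻¹),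
        Nonempty (ZetaSideInputsContra W p f κ γ I D Y)) :
    exists_zetaSideInputs_contra := by
  intro W _ _ p _ _ _ _ N _ f κ γ hp hord hκ hγ hγ' hf I D Y
  obtain ⟨I₀, D₀, Y₀, ⟨K⟩⟩ := h W p f κ γ hp hord hκ hγ hγ' hf
  obtain ⟨eI, heI⟩ := I₀.exists_linearEquiv I hγ
  obtain ⟨eD, -⟩ := WeierstrassCurve.SelmerDualData.exists_linearEquiv D₀ D
  obtain ⟨eY, -⟩ := WeierstrassCurve.FineSelmerDualData.exists_linearEquiv Y₀ Y
  exact K.nonempty_transport eI heI eD eY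

end Literature.NumberTheory.EllipticCurves.Kato2004

end
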